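import Summits.Ventures.CertifiedManyBodySolver.Downfold.EmeryFermiFillingHg1223IPSubs
import Summits.Ventures.CertifiedManyBodySolver.Downfold.EmeryFermiFillingLa214
import Summits.Ventures.CertifiedManyBodySolver.Downfold.EmeryBoxesTrilayer
import HarnessLib

/-!
# HgBa₂Ca₂Cu₃O₈₊δ INNER plane (box #35 Hg-1223; site-mean companion `emeryBoxHg1223IP`, CLASS-transfer U rows — one-body rows read only): the typed 3BE one-body box `emeryBoxHg1223IP` ⇒ a CERTIFIED window for the object-E Fermi-surface `t′/t` of the σ three-band
# model at the box's own hole count — and a certified MODEL-FORM CEILING against the E row of record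

Venture CertifiedManyBodySolver, cell `pub/hubbard-downfold` (stage S1, HUMAN RULINGS D-0096/D-0098), seat hubbard-downfold-mod-4 (technique B = band level);
namespace `Summit.Ventures.CertifiedManyBodySolver.Downfold.Emery`. Everything PROVED; numerics decided by the kernel (`EmeryFermiFillingHg1223IPSubs`).
Same device as `EmeryFermiFillingLa214` / `EmeryFermiFillingHg1201` / `EmeryFermiFillingLSCO`.

THE STATEMENT (`emeryBoxHg1223IP_fsRatio_window`). For every parameter vector of `emeryBoxHg1223IP` (`EmeryBoxesTrilayer`: the Hg-1223 INNER-plane companion's ONE-BODY rows (Δ_pd [1.23, 2.02] × t_pd [1.16, 1.44] × t_pp [0.60, 0.76] × t_pp′ [0.11, 0.22]; EXTRAPOLATED-grade object), n_H ∈ [1.14, 1.20]: Δ_pd [1.23, 2.02] × t_pd [1.16, 1.44] × t_pp [0.6, 0.76] × t_pp′ [0.11, 0.22]; n_H ∈ [1.14, 1.2])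
and every Fermi energy ε with `abFilling(ε) = (2 − n_H)/2` (the σ-model antibonding band holds the box's own electrons):
**`t′/t = fsRatio(ε) ∈ [-0.3623, -0.243]`** and **ε ∈ [1.22, 2.52]** (box units, eV above ε_d).

READING (certified): box #35's inner-plane object-E row `t′/t (E) @Cu-IP ∈ [−0.501, −0.379]` vs the σ-model window [-0.3623, -0.243] on the whole one-body box at the plane's own hole count — see the
corollary below (DISJOINT ⇒ certified MODEL-FORM CEILING; the OUTER-plane companion `emeryBoxHg1223OP` is not worded here: its Δ_pd row starts at −0.08 < 0, outside the device's
hypotheses).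

WHAT THIS IS NOT: not a statement that the material's parameters ARE in the box (SCREENING-GRADE provenance); the theorem certifies the REDUCTION STEP
of the σ d–p_x–p_y(+t_pp, t_pp′) model only; not the interaction (`U`) reduction; no phase sentence. Sources: [HybertsenSchluterChristensen1989, Eq. (1)];
[AndersenEtAl1995, §6]; [PavariniEtAl2001, Eq. (1)].
-/

noncomputable section

namespace Summit.Ventures.CertifiedManyBodySolver.Downfold.Emery

open Real Set
open Summit.Ventures.CertifiedManyBodySolver.Downfold

/-- Per-spin antibonding filling from the box's hole count: `n_H ∈ [57/50, 6/5] ⇒ (2 − n_H)/2 ∈ [2/5, 43/100]`. [folklore] -/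
theorem abFilling_rowHg1223IP_of_nHoles {nH f : ℝ} (h1 : (57 / 50 : ℝ) ≤ nH) (h2 : nH ≤ (6 / 5 : ℝ)) (hf : f = (2 - nH) / 2) :
    f ∈ Set.Icc (2 / 5 : ℝ) (43 / 100 : ℝ) := by
  rw [hf]; constructor <;> linarith

/-- **HgBa₂Ca₂Cu₃O₈₊δ INNER plane (box #35 Hg-1223; site-mean companion `emeryBoxHg1223IP`, CLASS-transfer U rows — one-body rows read only): 3BE box ⇒ object-E `t′/t` window (raw coordinates)** at per-spin filling ∈ [0.4, 0.43]:
`ε ∈ [1.22, 2.52]` and `t′/t ∈ [-0.3623, -0.243]`. [folklore] -/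
theorem hg1223IPBox_fsRatio_window {Δ tpd tpp c ε : ℝ} (hΔ : Δ ∈ Set.Icc (123 / 100 : ℝ) (101 / 50 : ℝ))
    (ha : tpd ∈ Set.Icc (29 / 25 : ℝ) (36 / 25 : ℝ)) (hb : tpp ∈ Set.Icc (3 / 5 : ℝ) (19 / 25 : ℝ))
    (hc : c ∈ Set.Icc (11 / 100 : ℝ) (11 / 50 : ℝ))
    (hν : abFilling Δ tpd tpp c ε ∈ Set.Icc (2 / 5 : ℝ) (43 / 100 : ℝ)) :
    ε ∈ Set.Icc (61 / 50 : ℝ) (63 / 25 : ℝ) ∧ fsRatio Δ tpd tpp c ε ∈ Set.Icc (-(3623 / 10000 : ℝ)) (-(243 / 1000 : ℝ)) := by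
  have hΔ' := hΔ
  constructor
  · clear hΔ
    rcases mem_Icc_split hΔ' (13 / 8 : ℝ) with hΔ' | hΔ'
    · rcases mem_Icc_split hΔ' (571 / 400 : ℝ) with hΔ' | hΔ'
      · rcases mem_Icc_split ha (13 / 10 : ℝ) with ha' | ha'
        · have h := (hg1223IPSub_0_0 hΔ' ha' hb hc hν).1
          exact ⟨le_trans (by norm_num) h.1, h.2.trans (by norm_num)⟩
        · have h := (hg1223IPSub_0_1 hΔ' ha' hb hc hν).1
          exact ⟨le_trans (by norm_num) h.1, h.2.trans (by norm_num)⟩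
      · rcases mem_Icc_split ha (13 / 10 : ℝ) with ha' | ha'
        · have h := (hg1223IPSub_1_0 hΔ' ha' hb hc hν).1
          exact ⟨le_trans (by norm_num) h.1, h.2.trans (by norm_num)⟩
        · have h := (hg1223IPSub_1_1 hΔ' ha' hb hc hν).1
          exact ⟨le_trans (by norm_num) h.1, h.2.trans (by norm_num)⟩
    · rcases mem_Icc_split hΔ' (729 / 400 : ℝ) with hΔ' | hΔ'
      · rcases mem_Icc_split ha (13 / 10 : ℝ) with ha' | ha'
        · have h := (hg1223IPSub_2_0 hΔ' ha' hb hc hν).1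
          exact ⟨le_trans (by norm_num) h.1, h.2.trans (by norm_num)⟩
        · have h := (hg1223IPSub_2_1 hΔ' ha' hb hc hν).1
          exact ⟨le_trans (by norm_num) h.1, h.2.trans (by norm_num)⟩
      · rcases mem_Icc_split ha (13 / 10 : ℝ) with ha' | ha'
        · have h := (hg1223IPSub_3_0 hΔ' ha' hb hc hν).1
          exact ⟨le_trans (by norm_num) h.1, h.2.trans (by norm_num)⟩
        · have h := (hg1223IPSub_3_1 hΔ' ha' hb hc hν).1
          exact ⟨le_trans (by norm_num) h.1, h.2.trans (by norm_num)⟩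
  · clear hΔ
    rcases mem_Icc_split hΔ' (13 / 8 : ℝ) with hΔ' | hΔ'
    · rcases mem_Icc_split hΔ' (571 / 400 : ℝ) with hΔ' | hΔ'
      · rcases mem_Icc_split ha (13 / 10 : ℝ) with ha' | ha'
        · have h := (hg1223IPSub_0_0 hΔ' ha' hb hc hν).2
          exact ⟨le_trans (by norm_num) h.1, h.2.trans (by norm_num)⟩
        · have h := (hg1223IPSub_0_1 hΔ' ha' hb hc hν).2
          exact ⟨le_trans (by norm_num) h.1, h.2.trans (by norm_num)⟩
      · rcases mem_Icc_split ha (13 / 10 : ℝ) with ha' | ha'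
        · have h := (hg1223IPSub_1_0 hΔ' ha' hb hc hν).2
          exact ⟨le_trans (by norm_num) h.1, h.2.trans (by norm_num)⟩
        · have h := (hg1223IPSub_1_1 hΔ' ha' hb hc hν).2
          exact ⟨le_trans (by norm_num) h.1, h.2.trans (by norm_num)⟩
    · rcases mem_Icc_split hΔ' (729 / 400 : ℝ) with hΔ' | hΔ'
      · rcases mem_Icc_split ha (13 / 10 : ℝ) with ha' | ha'
        · have h := (hg1223IPSub_2_0 hΔ' ha' hb hc hν).2
          exact ⟨le_trans (by norm_num) h.1, h.2.trans (by norm_num)⟩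
        · have h := (hg1223IPSub_2_1 hΔ' ha' hb hc hν).2
          exact ⟨le_trans (by norm_num) h.1, h.2.trans (by norm_num)⟩
      · rcases mem_Icc_split ha (13 / 10 : ℝ) with ha' | ha'
        · have h := (hg1223IPSub_3_0 hΔ' ha' hb hc hν).2
          exact ⟨le_trans (by norm_num) h.1, h.2.trans (by norm_num)⟩
        · have h := (hg1223IPSub_3_1 hΔ' ha' hb hc hν).2
          exact ⟨le_trans (by norm_num) h.1, h.2.trans (by norm_num)⟩

/-- The five rows of `emeryBoxHg1223IP` this file reads. [folklore] -/
theorem emeryBoxHg1223IP_mem_rows {p : EmeryCoord → ℝ} (hp : emeryBoxHg1223IP.Mem p) :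
    p .DeltaPd ∈ Set.Icc (123 / 100 : ℝ) (101 / 50 : ℝ) ∧ p .tpd ∈ Set.Icc (29 / 25 : ℝ) (36 / 25 : ℝ) ∧
      p .tpp ∈ Set.Icc (3 / 5 : ℝ) (19 / 25 : ℝ) ∧ p .tppP ∈ Set.Icc (11 / 100 : ℝ) (11 / 50 : ℝ) ∧
      p .nHoles ∈ Set.Icc (57 / 50 : ℝ) (6 / 5 : ℝ) := by
  have hΔ := (Entry.mem_ofEnds_iff _ _ _ _ _).1 (hp .DeltaPd hg1223IPEmery_Delta rfl)
  have ha := (Entry.mem_ofEnds_iff _ _ _ _ _).1 (hp .tpd hg1223IPEmery_tpd rfl)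
  have hb := (Entry.mem_ofEnds_iff _ _ _ _ _).1 (hp .tpp hg1223IPEmery_tpp rfl)
  have hc := (Entry.mem_ofEnds_iff _ _ _ _ _).1 (hp .tppP hg1223IPEmery_tppP rfl)
  have hn := (Entry.mem_ofEnds_iff _ _ _ _ _).1 (hp .nHoles hg1223Emery_nH rfl)
  push_cast at hΔ ha hb hc hn
  exact ⟨⟨hΔ.1, hΔ.2⟩, ⟨ha.1, ha.2⟩, ⟨hb.1, hb.2⟩, ⟨hc.1, hc.2⟩, ⟨hn.1, hn.2⟩⟩

/-- **THE WORD ON THE TYPED BOX `emeryBoxHg1223IP`**: at every parameter vector and every Fermi energy at which the σ-model antibonding band holds the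
box's own electron count, `ε ∈ [1.22, 2.52]` and the exact σ-model Fermi-surface `t′/t ∈ [-0.3623, -0.243]`.
[cite: HybertsenSchluterChristensen1989, Eq. (1) (three-band d–p model)] -/
theorem emeryBoxHg1223IP_fsRatio_window :
    HoldsOn (fun p : EmeryCoord → ℝ => ∀ ε : ℝ,
      abFilling (p .DeltaPd) (p .tpd) (p .tpp) (p .tppP) ε = (2 - p .nHoles) / 2 →
      ε ∈ Set.Icc (61 / 50 : ℝ) (63 / 25 : ℝ) ∧
      fsRatio (p .DeltaPd) (p .tpd) (p .tpp) (p .tppP) ε ∈ Set.Icc (-(3623 / 10000 : ℝ)) (-(243 / 1000 : ℝ))) emeryBoxHg1223IP := by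
  intro p hp ε hf
  obtain ⟨hΔ, ha, hb, hc, hn⟩ := emeryBoxHg1223IP_mem_rows hp
  exact hg1223IPBox_fsRatio_window hΔ ha hb hc (abFilling_rowHg1223IP_of_nHoles hn.1 hn.2 hf)

/-- **MODEL-FORM CEILING, CERTIFIED**: on the whole box the σ-model Fermi-surface `t′/t` window [-0.3623, -0.243] is DISJOINT from the object-E
row of record `[-0.501, -0.379]` (router/BOXES/HgBa2Ca2Cu3O8.md l.44 «tp/t (E) @Cu-IP [−0.501, −0.379]») — the d–p_x–p_y(+t_pp, t_pp′) model cannot produce this material's one-band Fermi-surface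
shape anywhere in its 3BE box. [folklore] -/
theorem emeryBoxHg1223IP_fsRatio_not_objectE :
    HoldsOn (fun p : EmeryCoord → ℝ => ∀ ε : ℝ,
      abFilling (p .DeltaPd) (p .tpd) (p .tpp) (p .tppP) ε = (2 - p .nHoles) / 2 →
      fsRatio (p .DeltaPd) (p .tpd) (p .tpp) (p .tppP) ε ∉ Set.Icc (-(501 / 1000 : ℝ)) (-(379 / 1000 : ℝ))) emeryBoxHg1223IP := by
  intro p hp ε hf hmem
  have h := (emeryBoxHg1223IP_fsRatio_window p hp ε hf).2
  have : (-(379 / 1000 : ℝ)) < (-(3623 / 10000 : ℝ)) := by norm_num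
  linarith [h.1, hmem.2]

end Summit.Ventures.CertifiedManyBodySolver.Downfold.Emery
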